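import Summits.FinalStateConjecture.FinalStateConjecture.Theorems.UniformPhotonSphereChannels.Negative.ConformalChainRule

/-!
# Crux `UniformPhotonSphereChannels` (K1), negative side — the solution in the near-horizon
# Minkowski (Rindler/Kruskal) frame

Support file of the standing disprover of item stmt-FinalStateConjecture-10045.  The Rindler
chart of the tortoise line, `X ± T = κ⁻¹ e^{κ(x ± t)}` (`κ = 1/4M` the surface gravity), is
realised with a globally smooth monotone modification `α` of `κ⁻¹ log(κ ·)` that agrees with it on
`[A₀, ∞)` (`exists_logMod`), and for a global `C³` solution `ψ` of `ψ_tt − ψ_xx + Vψ = 0` with even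
data supported in `[x₋, x₊]` the composite

`u(T, X) = ψ((α(X+T) − α(X−T))/2, (α(X+T) + α(X−T))/2)`

is a global `C³` solution of `u_TT − u_XX + W u = 0`,
`W(T,X) = V(x) α′(X+T) α′(X−T) ≥ 0` (`= e^{−2κx} V` on the Rindler chart), vanishing on
`{X + |T| < X₋}` and on `{X₊ < X − |T|}`, `X± = κ⁻¹ e^{κ x±}`, with `u_T(0, ·) = 0`
(`rindler_solution`).  This is the object to which the pinning files apply. [folklore]
-/

namespace Summit.FinalStateConjecture.FinalStateConjecture.Theorems

open Set Filter Topology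

noncomputable section

namespace WaveDefect

open WaveEnergy

/-- **The smooth logarithm.**  For `κ, A₀ > 0` there is a `C³` monotone `α : ℝ → ℝ` with
`α(a) = log(κa)/κ` on `[A₀, ∞)`, `α′(a) = 1/(κa)` on `(A₀, ∞)`, `α′ ≥ 0`, and
`α(a) < log(κB)/κ` whenever `a < B`, `A₀ ≤ B`. -/
theorem exists_logMod {κ A₀ : ℝ} (hκ : 0 < κ) (hA₀ : 0 < A₀) :
    ∃ α : ℝ → ℝ, ContDiff ℝ 3 α ∧ Monotone α ∧
      (∀ a, A₀ ≤ a → α a = Real.log (κ * a) / κ) ∧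
      (∀ a, A₀ < a → deriv α a = 1 / (κ * a)) ∧
      (∀ a, 0 ≤ deriv α a) ∧
      (∀ a B, A₀ ≤ B → a < B → α a < Real.log (κ * B) / κ) := by
  -- the soft floor `θ`: smooth, monotone, `≥ A₀/2`, `= id` on `[A₀, ∞)`, `≤ max a (A₀/2)`
  set S : ℝ → ℝ := fun a => Real.smoothTransition ((a - A₀ / 2) / (A₀ / 2)) with hS
  set θ : ℝ → ℝ := fun a => A₀ / 2 + (a - A₀ / 2) * S a with hθ
  have hS01 : ∀ a, 0 ≤ S a ∧ S a ≤ 1 := fun a =>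
    ⟨Real.smoothTransition.nonneg _, Real.smoothTransition.le_one _⟩
  have hS0 : ∀ a, a ≤ A₀ / 2 → S a = 0 := fun a ha =>
    Real.smoothTransition.zero_of_nonpos (div_nonpos_of_nonpos_of_nonneg (by linarith) (by linarith))
  have hS1 : ∀ a, A₀ ≤ a → S a = 1 := fun a ha =>
    Real.smoothTransition.one_of_one_le (by rw [le_div_iff₀ (by linarith)]; linarith)
  have hSmono : Monotone S := fun a b hab =>
    Real.smoothTransition.monotone (div_le_div_of_nonneg_right (by linarith) (by linarith))
  have hSsmooth : ContDiff ℝ 3 S :=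
    (Real.smoothTransition.contDiff (n := 3)).comp ((contDiff_id.sub contDiff_const).div_const _)
  have hθsmooth : ContDiff ℝ 3 θ := by
    simp only [hθ]
    exact contDiff_const.add ((contDiff_id.sub contDiff_const).mul hSsmooth)
  have hθlow : ∀ a, A₀ / 2 ≤ θ a := by
    intro a
    simp only [hθ]
    rcases le_or_gt a (A₀ / 2) with h | h
    · rw [hS0 a h]; linarith
    · nlinarith [(hS01 a).1]
  have hθpos : ∀ a, 0 < θ a := fun a => lt_of_lt_of_le (by linarith) (hθlow a)
  have hθid : ∀ a, A₀ ≤ a → θ a = a := fun a ha => by simp only [hθ, hS1 a ha]; ring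
  have hθle : ∀ a, θ a ≤ max a (A₀ / 2) := by
    intro a
    simp only [hθ]
    rcases le_or_gt a (A₀ / 2) with h | h
    · rw [hS0 a h]; simp
    · have : (a - A₀ / 2) * S a ≤ (a - A₀ / 2) * 1 :=
        mul_le_mul_of_nonneg_left (hS01 a).2 (by linarith)
      calc A₀ / 2 + (a - A₀ / 2) * S a ≤ a := by linarith
        _ ≤ max a (A₀ / 2) := le_max_left _ _
  have hθmono : Monotone θ := by
    intro a b hab
    simp only [hθ]
    rcases le_or_gt b (A₀ / 2) with hb | hb
    · rw [hS0 a (hab.trans hb), hS0 b hb]; simp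
    · rcases le_or_gt a (A₀ / 2) with ha | ha
      · rw [hS0 a ha]
        nlinarith [(hS01 b).1]
      · have h1 : (a - A₀ / 2) * S a ≤ (b - A₀ / 2) * S a :=
          mul_le_mul_of_nonneg_right (by linarith) (hS01 a).1
        have h2 : (b - A₀ / 2) * S a ≤ (b - A₀ / 2) * S b :=
          mul_le_mul_of_nonneg_left (hSmono hab) (by linarith)
        linarith
  -- `α = log(κ θ)/κ`
  refine ⟨fun a => Real.log (κ * θ a) / κ, ?_, ?_, ?_, ?_, ?_, ?_⟩
  · refine ContDiff.div_const ?_ _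
    exact (contDiff_const.mul hθsmooth).log fun a => (mul_pos hκ (hθpos a)).ne'
  · intro a b hab
    exact div_le_div_of_nonneg_right (Real.log_le_log (mul_pos hκ (hθpos a))
      (mul_le_mul_of_nonneg_left (hθmono hab) hκ.le)) hκ.le
  · intro a ha; simp only [hθid a ha]
  · intro a ha
    -- `α` agrees with `log(κ ·)/κ` on the open set `(A₀, ∞)`
    have hev : (fun a => Real.log (κ * θ a) / κ) =ᶠ[𝓝 a] fun a => Real.log (κ * a) / κ := by
      filter_upwards [Ioi_mem_nhds ha] with b hb
      simp only [hθid b (le_of_lt hb)]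
    rw [hev.deriv_eq]
    have hd : HasDerivAt (fun a => Real.log (κ * a) / κ) (κ / (κ * a) / κ) a := by
      have h1 : HasDerivAt (fun a => κ * a) κ a := by simpa using (hasDerivAt_id a).const_mul κ
      exact (h1.log (mul_pos hκ (hA₀.trans ha)).ne').div_const κ
    rw [hd.deriv]
    field_simp
  · intro a
    refine Monotone.deriv_nonneg fun b c hbc => ?_
    exact div_le_div_of_nonneg_right (Real.log_le_log (mul_pos hκ (hθpos b))
      (mul_le_mul_of_nonneg_left (hθmono hbc) hκ.le)) hκ.le
  · intro a B hB haB
    refine div_lt_div_of_pos_right (Real.log_lt_log (mul_pos hκ (hθpos a)) ?_) hκ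
    refine mul_lt_mul_of_pos_left (lt_of_le_of_lt (hθle a) ?_) hκ
    exact max_lt haB (by linarith)

variable {V : ℝ → ℝ} {ψ : ℝ → ℝ → ℝ} {α : ℝ → ℝ} {κ A₀ xl xr : ℝ}

/-- **The Rindler-frame solution.**  See the module docstring; `α` is any function with the
properties of `exists_logMod` (only those listed as hypotheses are used). [folklore] -/
theorem rindler_solution (hκ : 0 < κ) (hV : ContDiff ℝ 1 V) (hV0 : ∀ x, 0 ≤ V x)
    (hψ : ContDiff ℝ 3 (Function.uncurry ψ))
    (hsolψ : ∀ t x : ℝ, iteratedDeriv 2 (fun τ => ψ τ x) t - iteratedDeriv 2 (ψ t) x + V x * ψ t x = 0)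
    (hψt0 : ∀ x, deriv (fun τ => ψ τ x) 0 = 0)
    (hψzero : ∀ t x : ℝ, (x < xl - |t| ∨ xr + |t| < x) → ψ t x = 0)
    (hα : ContDiff ℝ 3 α)
    (hαlog : ∀ a, A₀ ≤ a → α a = Real.log (κ * a) / κ) (hα' : ∀ a, 0 ≤ deriv α a)
    (hαlt : ∀ a B, A₀ ≤ B → a < B → α a < Real.log (κ * B) / κ)
    (hXl : A₀ ≤ Real.exp (κ * xl) / κ) (hXr : A₀ ≤ Real.exp (κ * xr) / κ) :
    ContDiff ℝ 3 (fun z : ℝ × ℝ => ψ ((α (z.2 + z.1) - α (z.2 - z.1)) / 2) ((α (z.2 + z.1) + α (z.2 - z.1)) / 2)) ∧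
    ContDiff ℝ 1 (fun z : ℝ × ℝ => V ((α (z.2 + z.1) + α (z.2 - z.1)) / 2) * deriv α (z.2 + z.1) * deriv α (z.2 - z.1)) ∧
    (∀ z : ℝ × ℝ, 0 ≤ V ((α (z.2 + z.1) + α (z.2 - z.1)) / 2) * deriv α (z.2 + z.1) * deriv α (z.2 - z.1)) ∧
    (∀ z : ℝ × ℝ,
      fderiv ℝ (fderiv ℝ (fun z : ℝ × ℝ => ψ ((α (z.2 + z.1) - α (z.2 - z.1)) / 2)
        ((α (z.2 + z.1) + α (z.2 - z.1)) / 2))) z (1, 0) (1, 0)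
      - fderiv ℝ (fderiv ℝ (fun z : ℝ × ℝ => ψ ((α (z.2 + z.1) - α (z.2 - z.1)) / 2)
        ((α (z.2 + z.1) + α (z.2 - z.1)) / 2))) z (0, 1) (0, 1)
      + (V ((α (z.2 + z.1) + α (z.2 - z.1)) / 2) * deriv α (z.2 + z.1) * deriv α (z.2 - z.1))
        * ψ ((α (z.2 + z.1) - α (z.2 - z.1)) / 2) ((α (z.2 + z.1) + α (z.2 - z.1)) / 2) = 0) ∧
    (∀ z : ℝ × ℝ, z.2 + |z.1| < Real.exp (κ * xl) / κ →
      ψ ((α (z.2 + z.1) - α (z.2 - z.1)) / 2) ((α (z.2 + z.1) + α (z.2 - z.1)) / 2) = 0) ∧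
    (∀ z : ℝ × ℝ, Real.exp (κ * xr) / κ < z.2 - |z.1| →
      ψ ((α (z.2 + z.1) - α (z.2 - z.1)) / 2) ((α (z.2 + z.1) + α (z.2 - z.1)) / 2) = 0) ∧
    (∀ X : ℝ, fderiv ℝ (fun z : ℝ × ℝ => ψ ((α (z.2 + z.1) - α (z.2 - z.1)) / 2)
        ((α (z.2 + z.1) + α (z.2 - z.1)) / 2)) (0, X) (1, 0) = 0) := by
  set Ψ : ℝ × ℝ → ℝ := Function.uncurry ψ with hΨ
  have hΨ3 : ContDiff ℝ 3 Ψ := hψ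
  have hΨ2 : ContDiff ℝ 2 Ψ := hψ.of_le (by norm_num)
  have hα2 : ContDiff ℝ 2 α := hα.of_le (by norm_num)
  have hα'2 : ContDiff ℝ 2 (deriv α) := (contDiff_succ_iff_deriv.mp hα).2.2
  -- the composite as `Ψ ∘ S`
  have hfun : (fun z : ℝ × ℝ => ψ ((α (z.2 + z.1) - α (z.2 - z.1)) / 2) ((α (z.2 + z.1) + α (z.2 - z.1)) / 2))
      = fun z : ℝ × ℝ => Ψ ((α (z.2 + z.1) - α (z.2 - z.1)) / 2, (α (z.2 + z.1) + α (z.2 - z.1)) / 2) := by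
    funext z; rfl
  -- logarithm bookkeeping
  have hlogX : ∀ x, Real.log (κ * (Real.exp (κ * x) / κ)) / κ = x := by
    intro x
    rw [mul_div_cancel₀ _ hκ.ne', Real.log_exp, mul_div_cancel_left₀ _ hκ.ne']
  refine ⟨?_, ?_, ?_, ?_, ?_, ?_, ?_⟩
  · rw [hfun]; exact contDiff_conformal hΨ3 hα hα
  · have h1 : ContDiff ℝ 1 fun z : ℝ × ℝ => α (z.2 + z.1) := (hα.of_le (by norm_num)).comp (contDiff_snd.add contDiff_fst)
    have h2 : ContDiff ℝ 1 fun z : ℝ × ℝ => α (z.2 - z.1) := (hα.of_le (by norm_num)).comp (contDiff_snd.sub contDiff_fst)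
    have h3 : ContDiff ℝ 1 fun z : ℝ × ℝ => deriv α (z.2 + z.1) :=
      (hα'2.of_le (by norm_num)).comp (contDiff_snd.add contDiff_fst)
    have h4 : ContDiff ℝ 1 fun z : ℝ × ℝ => deriv α (z.2 - z.1) :=
      (hα'2.of_le (by norm_num)).comp (contDiff_snd.sub contDiff_fst)
    exact ((hV.comp ((h1.add h2).div_const 2)).mul h3).mul h4
  · intro z
    exact mul_nonneg (mul_nonneg (hV0 _) (hα' _)) (hα' _)
  · intro z
    obtain ⟨T, X⟩ := z
    rw [hfun, wave_conformal hΨ2 hα2 hα2 T X]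
    -- the equation for `ψ` at the image point, in Fréchet form
    set t : ℝ := (α (X + T) - α (X - T)) / 2 with ht
    set x : ℝ := (α (X + T) + α (X - T)) / 2 with hx
    have h1 := iteratedDeriv_two_slice_fst_eq (ψ := ψ) hΨ2 t x
    have h2 := iteratedDeriv_two_slice_snd_eq (ψ := ψ) hΨ2 t x
    have hs := hsolψ t x
    rw [h1, h2, ← hΨ] at hs
    show (fderiv ℝ (fderiv ℝ Ψ) (t, x) (1, 0) (1, 0) - fderiv ℝ (fderiv ℝ Ψ) (t, x) (0, 1) (0, 1))
        * (deriv α (X + T) * deriv α (X - T))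
      + V x * deriv α (X + T) * deriv α (X - T) * ψ t x = 0
    linear_combination (deriv α (X + T) * deriv α (X - T)) * hs
  · intro z hz
    have hA : z.2 + z.1 < Real.exp (κ * xl) / κ := by linarith [le_abs_self z.1]
    have hB : z.2 - z.1 < Real.exp (κ * xl) / κ := by linarith [neg_le_abs z.1]
    have h1 := hαlt _ _ hXl hA
    have h2 := hαlt _ _ hXl hB
    rw [hlogX] at h1 h2
    apply hψzero
    left
    -- `x + |t| < xl`
    have : (α (z.2 + z.1) + α (z.2 - z.1)) / 2 + |(α (z.2 + z.1) - α (z.2 - z.1)) / 2| < xl := by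
      rcases le_or_gt 0 ((α (z.2 + z.1) - α (z.2 - z.1)) / 2) with h | h
      · rw [abs_of_nonneg h]; linarith
      · rw [abs_of_neg h]; linarith
    linarith
  · intro z hz
    have hpos : 0 < Real.exp (κ * xr) / κ := div_pos (Real.exp_pos _) hκ
    have hA : Real.exp (κ * xr) / κ < z.2 + z.1 := by linarith [neg_le_abs z.1]
    have hB : Real.exp (κ * xr) / κ < z.2 - z.1 := by linarith [le_abs_self z.1]
    have h1 : xr < α (z.2 + z.1) := by
      rw [hαlog _ (hXr.trans hA.le), ← hlogX xr]
      exact div_lt_div_of_pos_right (Real.log_lt_log (mul_pos hκ hpos)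
        (mul_lt_mul_of_pos_left hA hκ)) hκ
    have h2 : xr < α (z.2 - z.1) := by
      rw [hαlog _ (hXr.trans hB.le), ← hlogX xr]
      exact div_lt_div_of_pos_right (Real.log_lt_log (mul_pos hκ hpos)
        (mul_lt_mul_of_pos_left hB hκ)) hκ
    apply hψzero
    right
    rcases le_or_gt 0 ((α (z.2 + z.1) - α (z.2 - z.1)) / 2) with h | h
    · rw [abs_of_nonneg h]; linarith
    · rw [abs_of_neg h]; linarith
  · intro X
    rw [hfun, (fderiv_conformal hΨ2 hα2 hα2 0 X).1]
    simp only [add_zero, sub_zero, sub_self, zero_div]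
    -- `DΨ(0, α X)(α'(X), 0) = α'(X) ψ_t(0, α X) = 0`
    have hd := hasDerivAt_slice_fst (differentiable_of_contDiff_two hΨ2) 0 (α X)
    have h0 : fderiv ℝ Ψ (0, α X) (1, 0) = 0 := by
      rw [← hd.deriv]; exact hψt0 (α X)
    have e1 : ((deriv α X + deriv α X) / 2, (0 : ℝ)) = ((deriv α X + deriv α X) / 2) • ((1 : ℝ), (0 : ℝ)) := by
      ext <;> simp
    have hsame : (α X - α X) / 2 = 0 := by ring
    rw [show ((α X + α X) / 2) = α X by ring, e1, map_smul, smul_eq_mul]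
    simp [h0]

end WaveDefect

end

end Summit.FinalStateConjecture.FinalStateConjecture.Theorems
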